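import Literature.AnabelianGeometry.SemiGraphs.TemperedPiRayApartment
import Literature.AnabelianGeometry.SemiGraphs.SubdivisionPaths
import HarnessLib

/-!
# The apartment of a Galois tower along a ray is a path of the trees: abutments ([SemiAnbd] Thm 3.7 (iii), p. 41)

Mochizuki, *Semi-graphs of anabelioids*, Publ. RIMS **42** (2006) [MochizukiSemiAnbd2006], §3: Def. 3.5
(i) p. 37 (the underlying semi-graph of a covering: "vertices … edges … the set of connected components",
branches abutting through the gluings) and Thm. 3.7 (iii) p. 41 ("a compatible system of vertices of
`𝒢_{∞,j}`", "images of '`π̂₁(𝒢_e)`'s'"). [cite: MochizukiSemiAnbd2006, Thm 3.7(iii) p.41]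

PROOF-ONLY file (abc-iut cell, FRONTIER programme REFUTE-F1732, brick R6c (c1), tree side; seat
abc-iut-w5-d160 gen 5 at the request of the (c1) holder abc-iut-L3-t11 gen 3; no definitions, no named
facts).  The ABUTMENTS of abc-iut-L3-t11's apartment (`TemperedPiRayApartment.lean`): for a Galois tower
`D : GaloisLevelData 𝒢` (abc-iut-L3-t9), an edge-point sequence `Q` over the edge `e` (abc-iut-L3-t6's
`EdgeSeq`) and a branch `b` of `e` abutting to `v`,

* `EdgeSeq.tree_abuts_treeIso_branchMap` — in the tree `𝔾̃_n = D.tree n` the branch of the edge `Q.edge n`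
  lying over `b` ABUTS to the vertex `(Q.gluePointSeq b v hb hbe).vertex n` of the point sequence glued
  along `b` (Def. 3.5 (i): the branch over `b : e → v` of the orbit of `y ∈ S_e` abuts to the orbit of
  `glue_b(y) ∈ S_v`, transported along the identification `treeIso : 𝔾_{𝒢_{∞,n}} ≅ 𝔾̃_n` of (B5));
  the branch is unique (`tree_abuts_of_branchMap_eq`: ANY branch of `Q.edge n` over `b` abuts there);
  `EdgeAbuts` / `Joins` forms; `EdgeSeq.treeProj_edgeMap_edge` (`Q.edge n` lies over `e`);
* along a ray of closed edges (`rayPointSeq` / `rayEdgeSeq` of abc-iut-L3-t11): the `k`-th edge of the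
  apartment JOINS the `k`-th vertex to the `(k+1)`-st at every level (`tree_joins_rayEdge`), its branch over
  `βm k` abutting to `(rayPointSeq k).vertex n` and its branch over `βp k` to `(rayPointSeq (k+1)).vertex n`;
  consecutive apartment vertices are DISTINCT as soon as `βm k ≠ βp k` (a tree has no loops,
  `branch_unique_of_isAcyclic`) and consecutive-or-not they lie over the ray (`treeProj_vertexMap_rayVertex`,
  t11) — so the apartment is the lift of the ray through `P₀`, a path in each tree `𝔾̃_n`.

Consumer: abc-iut-L3-d4's escape criterion at the desk countermodel `𝒢_θ` of abc-iut-L3-d1 (memo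
HOME/staging/L3/L3-d1/g3/COUNTERMODEL-Thm37iii-infinite.md) — towards a kernel erratum for the
∀-countable reading of [SemiAnbd] Thm 3.7 (iii) ([IUTchI] Rmk 2.5.3); print proves finite `𝔾` (kernel:
`compactInVerticialAt_of_finiteGraph`).  Nothing here bears on [IUTchIII] Cor. 3.12; typed ≠ proved.
-/

namespace Literature.AnabelianGeometry.SemiGraphs

namespace ProfiniteSemiGraph

namespace GaloisLevelData

open CategoryTheory Topology

universe u

variable {𝒢 : ProfiniteSemiGraph.{u}} {D : GaloisLevelData 𝒢} {h𝒢 : 𝒢.IsCountable}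

namespace EdgeSeq

variable {e : 𝒢.graph.Edge} (Q : D.EdgeSeq h𝒢 e)
  (b : 𝒢.graph.Branch) (v : 𝒢.graph.Vertex) (hb : 𝒢.graph.abuts b = some v)
  (hbe : 𝒢.graph.edgeOf b = e)

/-! ### The tree edge of an edge-point sequence lies over its base edge -/

/-- The tree edge `Q.edge n` of an edge-point sequence over `e` lies over `e`.
[cite: MochizukiSemiAnbd2006, Thm 3.7(iii) p.41] -/
theorem treeProj_edgeMap_edge (n : ℕ) : (D.treeProj n).edgeMap (Q.edge n) = e := by
  change ((D.treeIso h𝒢 n).hom ≫ D.treeProj n).edgeMap (Quot.mk _ ⟨e, Q.pt n⟩) = e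
  rw [D.treeIso_hom_comp_treeProj h𝒢 n]
  rfl

/-! ### The branch of `Q.edge n` over `b` and the vertex it abuts to -/

/-- **Abutment of the glued point sequence** (Def. 3.5 (i) transported to the tree `𝔾̃_n`): the branch of
the tree edge `Q.edge n` over the branch `b : e → v` — the image under `treeIso` of the branch `(b, [Q.pt n])`
of the underlying semi-graph of `𝒢_{∞,n}` — abuts to the level-`n` vertex of the point sequence
`Q.gluePointSeq b v hb hbe` glued along `b`. [cite: MochizukiSemiAnbd2006, Def 3.5(i) p.37] -/
theorem tree_abuts_treeIso_branchMap (n : ℕ) :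
    (D.tree n).abuts ((D.treeIso h𝒢 n).hom.branchMap ⟨(b, Quot.mk _ ⟨e, Q.pt n⟩), hbe.symm⟩) =
      some ((Q.gluePointSeq b v hb hbe).vertex n) := by
  subst hbe
  refine (D.treeIso h𝒢 n).hom.abuts_branchMap _ (Quot.mk _ ⟨v, (Q.gluePointSeq b v hb rfl).pt n⟩) ?_
  rw [(D.cover h𝒢 n).orbitGraph_abuts_of_abuts b _ rfl v hb, (D.cover h𝒢 n).glueOpt_mk]
  rfl

/-- The branch of `tree_abuts_treeIso_branchMap` is a branch of the tree edge `Q.edge n`.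
[cite: MochizukiSemiAnbd2006, Def 3.5(i) p.37] -/
theorem edgeOf_treeIso_branchMap (n : ℕ) :
    (D.tree n).edgeOf ((D.treeIso h𝒢 n).hom.branchMap ⟨(b, Quot.mk _ ⟨e, Q.pt n⟩), hbe.symm⟩) =
      Q.edge n :=
  (D.treeIso h𝒢 n).hom.edgeOf_branchMap _

/-- The branch of `tree_abuts_treeIso_branchMap` lies over `b`. [cite: MochizukiSemiAnbd2006, Def 3.5(i) p.37] -/
theorem treeProj_branchMap_treeIso_branchMap (n : ℕ) :
    (D.treeProj n).branchMap ((D.treeIso h𝒢 n).hom.branchMap ⟨(b, Quot.mk _ ⟨e, Q.pt n⟩), hbe.symm⟩) =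
      b := by
  change ((D.treeIso h𝒢 n).hom ≫ D.treeProj n).branchMap ⟨(b, Quot.mk _ ⟨e, Q.pt n⟩), hbe.symm⟩ = b
  rw [D.treeIso_hom_comp_treeProj h𝒢 n]
  rfl

/-- **Existential form**: the tree edge `Q.edge n` has a branch over `b` abutting to the vertex of the
glued point sequence. [cite: MochizukiSemiAnbd2006, Def 3.5(i) p.37] -/
theorem exists_branch_abuts_gluePointSeq_vertex (n : ℕ) :
    ∃ β : (D.tree n).Branch, (D.tree n).edgeOf β = Q.edge n ∧ (D.treeProj n).branchMap β = b ∧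
      (D.tree n).abuts β = some ((Q.gluePointSeq b v hb hbe).vertex n) :=
  ⟨_, Q.edgeOf_treeIso_branchMap b hbe n, Q.treeProj_branchMap_treeIso_branchMap b hbe n,
    Q.tree_abuts_treeIso_branchMap b v hb hbe n⟩

/-- **Uniqueness form**: ANY branch of the tree edge `Q.edge n` lying over `b` abuts to the vertex of the
glued point sequence (a morphism of semi-graphs is injective on the branches of an edge).
[cite: MochizukiSemiAnbd2006, Def 3.5(i) p.37] -/
theorem tree_abuts_of_branchMap_eq (n : ℕ) (β : (D.tree n).Branch)
    (hβe : (D.tree n).edgeOf β = Q.edge n) (hβb : (D.treeProj n).branchMap β = b) :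
    (D.tree n).abuts β = some ((Q.gluePointSeq b v hb hbe).vertex n) := by
  have hβ : β = (D.treeIso h𝒢 n).hom.branchMap ⟨(b, Quot.mk _ ⟨e, Q.pt n⟩), hbe.symm⟩ :=
    (D.treeProj n).branchMap_injOn _ _ (hβe.trans (Q.edgeOf_treeIso_branchMap b hbe n).symm)
      (hβb.trans (Q.treeProj_branchMap_treeIso_branchMap b hbe n).symm)
  rw [hβ]
  exact Q.tree_abuts_treeIso_branchMap b v hb hbe n

/-- The tree edge `Q.edge n` abuts to the vertex of the point sequence glued along `b`.
[cite: MochizukiSemiAnbd2006, Thm 3.7(iii) p.41] -/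
theorem edgeAbuts_edge_gluePointSeq_vertex (n : ℕ) :
    (D.tree n).EdgeAbuts (Q.edge n) ((Q.gluePointSeq b v hb hbe).vertex n) :=
  ⟨_, Q.edgeOf_treeIso_branchMap b hbe n, Q.tree_abuts_treeIso_branchMap b v hb hbe n⟩

/-- **The tree edge of an edge-point sequence joins the two glued vertices**: for the two (distinct)
branches `b₁`, `b₂` of `e`, abutting to `v₁`, `v₂`, the tree edge `Q.edge n` joins
`(Q.gluePointSeq b₁ …).vertex n` to `(Q.gluePointSeq b₂ …).vertex n`. [cite: MochizukiSemiAnbd2006, Thm 3.7(iii) p.41] -/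
theorem joins_edge_gluePointSeq_vertex (n : ℕ) (b₁ b₂ : 𝒢.graph.Branch) (hne : b₁ ≠ b₂)
    (v₁ v₂ : 𝒢.graph.Vertex) (hb₁ : 𝒢.graph.abuts b₁ = some v₁) (hb₂ : 𝒢.graph.abuts b₂ = some v₂)
    (hb₁e : 𝒢.graph.edgeOf b₁ = e) (hb₂e : 𝒢.graph.edgeOf b₂ = e) :
    (D.tree n).Joins (Q.edge n) ((Q.gluePointSeq b₁ v₁ hb₁ hb₁e).vertex n)
      ((Q.gluePointSeq b₂ v₂ hb₂ hb₂e).vertex n) := by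
  refine ⟨_, _, fun h => hne ?_, Q.edgeOf_treeIso_branchMap b₁ hb₁e n,
    Q.edgeOf_treeIso_branchMap b₂ hb₂e n, Q.tree_abuts_treeIso_branchMap b₁ v₁ hb₁ hb₁e n,
    Q.tree_abuts_treeIso_branchMap b₂ v₂ hb₂ hb₂e n⟩
  have h' := congrArg (D.treeProj n).branchMap h
  rwa [Q.treeProj_branchMap_treeIso_branchMap b₁ hb₁e n,
    Q.treeProj_branchMap_treeIso_branchMap b₂ hb₂e n] at h'

/-- **The two glued vertices are distinct** when the branches are: a tree has no loops (an edge of a tree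
has at most one branch at a given vertex). [cite: MochizukiSemiAnbd2006, Thm 3.7(iii) p.41] -/
theorem gluePointSeq_vertex_ne (n : ℕ) (b₁ b₂ : 𝒢.graph.Branch) (hne : b₁ ≠ b₂)
    (v₁ v₂ : 𝒢.graph.Vertex) (hb₁ : 𝒢.graph.abuts b₁ = some v₁) (hb₂ : 𝒢.graph.abuts b₂ = some v₂)
    (hb₁e : 𝒢.graph.edgeOf b₁ = e) (hb₂e : 𝒢.graph.edgeOf b₂ = e) :
    (Q.gluePointSeq b₁ v₁ hb₁ hb₁e).vertex n ≠ (Q.gluePointSeq b₂ v₂ hb₂ hb₂e).vertex n := by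
  intro heq
  obtain ⟨β₁, β₂, hβne, hβ₁e, hβ₂e, hβ₁, hβ₂⟩ :=
    Q.joins_edge_gluePointSeq_vertex n b₁ b₂ hne v₁ v₂ hb₁ hb₂ hb₁e hb₂e
  rw [heq] at hβ₁
  exact hβne (SemiGraph.branch_unique_of_isAcyclic (D.isTree_tree n).isTree.isAcyclic
    (hβ₁e.trans hβ₂e.symm) hβ₁ hβ₂)

end EdgeSeq

/-! ### The apartment along a ray: the `k`-th edge joins the `k`-th vertex to the `(k+1)`-st -/

section Ray

variable {v : ℕ → 𝒢.graph.Vertex} {βm βp : ℕ → 𝒢.graph.Branch}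
  (ham : ∀ k, 𝒢.graph.abuts (βm k) = some (v k))
  (hap : ∀ k, 𝒢.graph.abuts (βp k) = some (v (k + 1)))
  (hmp : ∀ k, 𝒢.graph.edgeOf (βp k) = 𝒢.graph.edgeOf (βm k))
  (P₀ : D.PointSeq h𝒢 (v 0))

/-- The edges of the apartment lie over the ray: `(rayEdgeSeq k).edge n` lies over the `k`-th edge.
[cite: MochizukiSemiAnbd2006, Thm 3.7(iii) p.41] -/
theorem treeProj_edgeMap_rayEdge (k n : ℕ) :
    (D.treeProj n).edgeMap ((rayEdgeSeq ham hap hmp P₀ k).edge n) = 𝒢.graph.edgeOf (βm k) :=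
  (rayEdgeSeq ham hap hmp P₀ k).treeProj_edgeMap_edge n

/-- **The branch of the `k`-th apartment edge over `βm k` abuts to the `k`-th apartment vertex** (any such
branch). [cite: MochizukiSemiAnbd2006, Thm 3.7(iii) p.41] -/
theorem tree_abuts_rayVertex_of_branchMap_eq (k n : ℕ) (β : (D.tree n).Branch)
    (hβe : (D.tree n).edgeOf β = (rayEdgeSeq ham hap hmp P₀ k).edge n)
    (hβb : (D.treeProj n).branchMap β = βm k) :
    (D.tree n).abuts β = some ((rayPointSeq ham hap hmp P₀ k).vertex n) := by
  rw [← gluePointSeq_rayEdgeSeq ham hap hmp P₀ k]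
  exact (rayEdgeSeq ham hap hmp P₀ k).tree_abuts_of_branchMap_eq (βm k) (v k) (ham k) rfl n β hβe hβb

/-- **The branch of the `k`-th apartment edge over `βp k` abuts to the `(k+1)`-st apartment vertex** (any
such branch). [cite: MochizukiSemiAnbd2006, Thm 3.7(iii) p.41] -/
theorem tree_abuts_rayVertex_succ_of_branchMap_eq (k n : ℕ) (β : (D.tree n).Branch)
    (hβe : (D.tree n).edgeOf β = (rayEdgeSeq ham hap hmp P₀ k).edge n)
    (hβb : (D.treeProj n).branchMap β = βp k) :
    (D.tree n).abuts β = some ((rayPointSeq ham hap hmp P₀ (k + 1)).vertex n) := by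
  rw [rayPointSeq_succ]
  exact (rayEdgeSeq ham hap hmp P₀ k).tree_abuts_of_branchMap_eq (βp k) (v (k + 1)) (hap k) (hmp k) n β
    hβe hβb

/-- The `k`-th apartment edge abuts to the `k`-th apartment vertex. [cite: MochizukiSemiAnbd2006, Thm 3.7(iii) p.41] -/
theorem edgeAbuts_rayEdge_rayVertex (k n : ℕ) :
    (D.tree n).EdgeAbuts ((rayEdgeSeq ham hap hmp P₀ k).edge n) ((rayPointSeq ham hap hmp P₀ k).vertex n) := by
  rw [← gluePointSeq_rayEdgeSeq ham hap hmp P₀ k]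
  exact (rayEdgeSeq ham hap hmp P₀ k).edgeAbuts_edge_gluePointSeq_vertex (βm k) (v k) (ham k) rfl n

/-- The `k`-th apartment edge abuts to the `(k+1)`-st apartment vertex. [cite: MochizukiSemiAnbd2006, Thm 3.7(iii) p.41] -/
theorem edgeAbuts_rayEdge_rayVertex_succ (k n : ℕ) :
    (D.tree n).EdgeAbuts ((rayEdgeSeq ham hap hmp P₀ k).edge n)
      ((rayPointSeq ham hap hmp P₀ (k + 1)).vertex n) := by
  rw [rayPointSeq_succ]
  exact (rayEdgeSeq ham hap hmp P₀ k).edgeAbuts_edge_gluePointSeq_vertex (βp k) (v (k + 1)) (hap k) (hmp k) n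

/-- **The apartment is a lift of the ray**: at every level `n` the `k`-th apartment edge JOINS the `k`-th
apartment vertex to the `(k+1)`-st (for the two branches `βm k ≠ βp k` of the `k`-th edge of the ray).
[cite: MochizukiSemiAnbd2006, Thm 3.7(iii) p.41] -/
theorem tree_joins_rayEdge (hne : ∀ k, βm k ≠ βp k) (k n : ℕ) :
    (D.tree n).Joins ((rayEdgeSeq ham hap hmp P₀ k).edge n) ((rayPointSeq ham hap hmp P₀ k).vertex n)
      ((rayPointSeq ham hap hmp P₀ (k + 1)).vertex n) := by
  have h := (rayEdgeSeq ham hap hmp P₀ k).joins_edge_gluePointSeq_vertex n (βm k) (βp k) (hne k) (v k)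
    (v (k + 1)) (ham k) (hap k) rfl (hmp k)
  rwa [gluePointSeq_rayEdgeSeq ham hap hmp P₀ k, ← rayPointSeq_succ] at h

/-- **Consecutive apartment vertices are distinct** (for `βm k ≠ βp k`): a tree has no loops.
[cite: MochizukiSemiAnbd2006, Thm 3.7(iii) p.41] -/
theorem rayVertex_ne_succ (hne : ∀ k, βm k ≠ βp k) (k n : ℕ) :
    (rayPointSeq ham hap hmp P₀ k).vertex n ≠ (rayPointSeq ham hap hmp P₀ (k + 1)).vertex n := by
  have h := (rayEdgeSeq ham hap hmp P₀ k).gluePointSeq_vertex_ne n (βm k) (βp k) (hne k) (v k)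
    (v (k + 1)) (ham k) (hap k) rfl (hmp k)
  rwa [gluePointSeq_rayEdgeSeq ham hap hmp P₀ k, ← rayPointSeq_succ] at h

/-- In the subdivision of the tree `𝔾̃_n`, consecutive apartment vertices are joined by the walk
vertex – branch – edge – branch – vertex through the `k`-th apartment edge (length `4`); so the apartment
vertices `0, …, k` are reachable from one another inside the apartment. [cite: MochizukiSemiAnbd2006, Thm 3.7(iii) p.41] -/
theorem subdivision_reachable_rayVertex_succ (k n : ℕ) :
    (D.tree n).subdivision.Reachable (Sum.inl ((rayPointSeq ham hap hmp P₀ k).vertex n))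
      (Sum.inl ((rayPointSeq ham hap hmp P₀ (k + 1)).vertex n)) := by
  obtain ⟨β₁, hβ₁e, hβ₁⟩ := edgeAbuts_rayEdge_rayVertex ham hap hmp P₀ k n
  obtain ⟨β₂, hβ₂e, hβ₂⟩ := edgeAbuts_rayEdge_rayVertex_succ ham hap hmp P₀ k n
  have a₁ : (D.tree n).subdivision.Adj (Sum.inl ((rayPointSeq ham hap hmp P₀ k).vertex n))
      (Sum.inr (Sum.inr β₁)) :=
    ((D.tree n).subdivision_adj_inl_iff _ _).mpr ⟨β₁, hβ₁, rfl⟩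
  have a₂ : (D.tree n).subdivision.Adj (Sum.inr (Sum.inr β₁))
      (Sum.inr (Sum.inl ((rayEdgeSeq ham hap hmp P₀ k).edge n))) :=
    ((D.tree n).subdivision_adj_branch_iff _ _).mpr (Or.inl (by rw [hβ₁e]))
  have a₃ : (D.tree n).subdivision.Adj (Sum.inr (Sum.inl ((rayEdgeSeq ham hap hmp P₀ k).edge n)))
      (Sum.inr (Sum.inr β₂)) :=
    ((D.tree n).subdivision_adj_edge_iff _ _).mpr ⟨β₂, hβ₂e, rfl⟩
  have a₄ : (D.tree n).subdivision.Adj (Sum.inr (Sum.inr β₂))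
      (Sum.inl ((rayPointSeq ham hap hmp P₀ (k + 1)).vertex n)) :=
    ((D.tree n).subdivision_adj_branch_iff _ _).mpr (Or.inr ⟨_, hβ₂, rfl⟩)
  exact a₁.reachable.trans (a₂.reachable.trans (a₃.reachable.trans a₄.reachable))

/-- The apartment vertices are mutually reachable in the subdivision of every tree `𝔾̃_n` along the
apartment. [cite: MochizukiSemiAnbd2006, Thm 3.7(iii) p.41] -/
theorem subdivision_reachable_rayVertex (k l n : ℕ) :
    (D.tree n).subdivision.Reachable (Sum.inl ((rayPointSeq ham hap hmp P₀ k).vertex n))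
      (Sum.inl ((rayPointSeq ham hap hmp P₀ l).vertex n)) := by
  have step : ∀ m, (D.tree n).subdivision.Reachable (Sum.inl ((rayPointSeq ham hap hmp P₀ 0).vertex n))
      (Sum.inl ((rayPointSeq ham hap hmp P₀ m).vertex n)) := by
    intro m
    induction m with
    | zero => exact SimpleGraph.Reachable.refl _
    | succ m ih => exact ih.trans (subdivision_reachable_rayVertex_succ ham hap hmp P₀ m n)
  exact (step k).symm.trans (step l)

end Ray

end GaloisLevelData

end ProfiniteSemiGraph

end Literature.AnabelianGeometry.SemiGraphs
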